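import Summits.ValiantsHypothesis.ValiantsHypothesis.Theorems.LacunarySymmetroidMatrixDescartesCensusTwistedRolleMult
import Summits.ValiantsHypothesis.ValiantsHypothesis.Theorems.LacunarySymmetroidMatrixDescartesCensusPivotTwoDescartes
import Literature.Algebra.Polynomial.DescartesSignVariations

/-!
# `MatrixDescartes` (stmt-ValiantsHypothesis-18050) — the W-law at `n = 2`, TOOLS for `WLawAt 2 6`
# (one-root lemma, four-nomial lemma, the lever `det(A)·mix(B,Q) ≤ mix(A,B)·mix(A,Q)`, chamber multiplier inequalities)

HONEST FRAMING.  Cell `pub-symmetroid`, seat `val-sym-mdr-p1` (gen 5); helper `--supports` the crux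
`Theses.LacunarySymmetroid.MatrixDescartes` (OPEN, on HOLD), NO closure claim.  This file holds the real-polynomial and
`2 × 2`-matrix tools of the companion file `…WLawTwoSix.lean`, which proves the typed candidate row `WLawAt 2 6` of
`…WLawDefs` (every `2 × 2` W-configuration `X^e J + X^{d₁} P₁ + X^{d₂} P₂ + X^{d₃} Q`, `d₂ < d₁ < e < d₃`, `P₁, P₂, Q ⪰ 0`,
has at most SIX distinct positive zeros of its determinant — the `n = 2` W-constant is exactly `6 = 3n`).  Nothing here
bears on `WLaw` for `n ≥ 3`, on `MatrixDescartes` in its window, on `DoorA26` / `DoorA34`, on the cell's registers, or on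
`VP ≠ VNP`.

CONTENT (all elementary; positive roots are counted WITH multiplicity, `#Z₊^{mult}(f) = f.roots.countP (0 < ·)`, the
currency of the tree's twisted-Rolle file `…CensusTwistedRolleMult`):
* `countP_posRoots_le_one_of_pos_of_deriv_neg` — positive on `(0, x₀)`, negative derivative on `[x₀, ∞)` ⇒ `#Z₊^{mult} ≤ 1`;
* `fourNomial_countP_posRoots_le_one` — **FOUR-NOMIAL LEMMA**: `A X^p − B X^{p+g} + C X^{p+q} − D X^{p+q+g}` with
  `A, B, C, D ≥ 0`, `B C ≤ A D`, `g ≥ 1` has `#Z₊^{mult} ≤ 1` (positive while `D X^g < C`, strictly decreasing after);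
* `lever` — for ANY real symmetric `2 × 2` matrix `A` and PSD `B, Q`: `det(A)·mix(B,Q) ≤ mix(A,B)·mix(A,Q)` where
  `mix(X,Y) = x₁₁y₂₂ + x₂₂y₁₁ − 2x₁₂y₁₂` is the mixed discriminant (the identity
  `mix(A,B)mix(A,Q) − det(A)mix(B,Q) = tr(adj(A)·B·adj(A)·Q)`, a pairing of two PSD matrices; paper version: seat g4,
  WLAW-N2-CHAMBERS.md §3); `eq_zero_of_mix_nonpos` — `B ≻ 0`, `A ⪰ 0`, `mix(B,A) ≤ 0 ⇒ A = 0`; `mix_nonneg'`;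
* `multiplier_ineq_six` — the exponent inequality of the twist chain on the chamber `0 < a < g < c < a + g`:
  `8(g−a)(2a+c)(c−g)(a+g−c)(a+g+c)² ≤ (2g+a+c)(2a+g)(2a+g+c)(2a+2c+g)(g+c)(c−a)` (true minimum of the ratio over the
  chamber ≈ 33; the five-factor variant needed when `det P₂ = 0` follows from it inside `fiveNomial_countP_posRoots_le_one`);
* `twist_add`, `twist_C_mul_X_pow`, `eval_X_mul_derivative_fourNomial` — bookkeeping for the Euler twist `X·f′ − E·f`.

[folklore] Rolle / Descartes with multiplicity (Mathlib `Polynomial.roots_countP_pos_le_signVariations`, tree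
`Census.countP_posRoots_le_countP_posRoots_twist_succ`), mixed discriminants of `2 × 2` matrices; no single source.
-/

-- `Summit.ValiantsHypothesis.ValiantsHypothesis.…` repeats a component by the D-0017 layout
-- (single-conjunct summit), which the `dupNamespace` linter flags; the name is mandated.
set_option linter.dupNamespace false

namespace Summit.ValiantsHypothesis.ValiantsHypothesis.Theorems.LacunarySymmetroidMatrixDescartes.WLawTwoSix

open Polynomial Finset
open scoped BigOperators Polynomial

/-! ### 1. Euler twists of explicit fewnomials -/

/-- The Euler twist is additive: `X(p+q)′ − E(p+q) = (Xp′ − Ep) + (Xq′ − Eq)`. [folklore] -/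
theorem twist_add (E : ℝ) (p q : ℝ[X]) :
    X * derivative (p + q) - C E * (p + q) = (X * derivative p - C E * p) + (X * derivative q - C E * q) := by
  rw [derivative_add]; ring

/-- The Euler twist acts diagonally on monomials: `X(aXⁿ)′ − E·aXⁿ = a(n − E)Xⁿ`. [folklore] -/
theorem twist_C_mul_X_pow (E a : ℝ) (n : ℕ) :
    X * derivative (C a * X ^ n) - C E * (C a * X ^ n) = C (a * ((n : ℝ) - E)) * X ^ n := by
  ext k
  rw [coeff_C_mul, Census.coeff_X_mul_derivative_sub_C_mul, coeff_C_mul, coeff_X_pow]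
  split_ifs with h
  · subst h; ring
  · ring

/-- Euler's operator on a four-term fewnomial, evaluated: `x · φ′(x) = ∑ nᵢ cᵢ x^{nᵢ}`. [folklore] -/
theorem eval_X_mul_derivative_fourNomial (c₁ c₂ c₃ c₄ : ℝ) (n₁ n₂ n₃ n₄ : ℕ) (x : ℝ) :
    (X * derivative (C c₁ * X ^ n₁ + C c₂ * X ^ n₂ + C c₃ * X ^ n₃ + C c₄ * X ^ n₄)).eval x
      = n₁ * c₁ * x ^ n₁ + n₂ * c₂ * x ^ n₂ + n₃ * c₃ * x ^ n₃ + n₄ * c₄ * x ^ n₄ := by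
  have key : ∀ (c : ℝ) (n : ℕ), (X * derivative (C c * X ^ n)).eval x = n * c * x ^ n := by
    intro c n
    rw [derivative_C_mul_X_pow]
    rcases n with _ | k
    · simp
    · rw [show k + 1 - 1 = k from rfl, eval_mul, eval_X, eval_mul, eval_C, eval_pow, eval_X, pow_succ]
      push_cast
      ring
  simp only [derivative_add, mul_add, eval_add, key]

/-! ### 2. At most one positive root: positive first, strictly decreasing after -/

/-- If a real polynomial is positive on `(0, x₀)` and has negative derivative on `[x₀, ∞) ∩ (0, ∞)`, then it has at
most one positive root, multiplicities included (the root, if any, is simple). [folklore] -/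
theorem countP_posRoots_le_one_of_pos_of_deriv_neg (φ : ℝ[X]) (x₀ : ℝ)
    (hpos : ∀ x, 0 < x → x < x₀ → 0 < φ.eval x)
    (hder : ∀ x, x₀ ≤ x → 0 < x → φ.derivative.eval x < 0) :
    φ.roots.countP (fun x => 0 < x) ≤ 1 := by
  classical
  have hφ : φ ≠ 0 := by
    intro h
    have h1 := hder (max x₀ 1) (le_max_left _ _) (lt_of_lt_of_le one_pos (le_max_right _ _))
    rw [h, derivative_zero, eval_zero] at h1
    exact lt_irrefl 0 h1
  set S : Set ℝ := Set.Ici x₀ ∩ Set.Ioi 0 with hS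
  have hconv : Convex ℝ S := (convex_Ici x₀).inter (convex_Ioi 0)
  have hanti : StrictAntiOn (fun x => φ.eval x) S := by
    refine strictAntiOn_of_deriv_neg hconv (φ.continuous.continuousOn) fun x hx => ?_
    have hx' : x ∈ S := interior_subset hx
    rw [Polynomial.deriv]
    exact hder x hx'.1 hx'.2
  have hroot_mem : ∀ x, 0 < x → φ.IsRoot x → x ∈ S := by
    intro x hx hr
    refine ⟨?_, hx⟩
    by_contra hlt
    rw [Set.mem_Ici, not_le] at hlt
    have := hpos x hx hlt
    rw [hr.eq_zero] at this
    exact lt_irrefl 0 this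
  have hcard : (φ.roots.toFinset.filter (fun x => 0 < x)).card ≤ 1 := by
    rw [Finset.card_le_one]
    intro a ha b hb
    simp only [Finset.mem_filter, Multiset.mem_toFinset, mem_roots hφ] at ha hb
    exact hanti.injOn (hroot_mem a ha.2 ha.1) (hroot_mem b hb.2 hb.1) (by rw [ha.1.eq_zero, hb.1.eq_zero])
  have hmult : ∀ x ∈ φ.roots.toFinset.filter (fun x => 0 < x), φ.rootMultiplicity x ≤ 1 := by
    intro x hx
    simp only [Finset.mem_filter, Multiset.mem_toFinset, mem_roots hφ] at hx
    by_contra h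
    rw [not_le] at h
    have hd := ((Polynomial.one_lt_rootMultiplicity_iff_isRoot hφ).mp h).2
    have hxS := hroot_mem x hx.2 hx.1
    have := hder x hxS.1 hxS.2
    rw [hd.eq_zero] at this
    exact lt_irrefl 0 this
  rw [Census.countP_posRoots_eq_sum_rootMultiplicity]
  calc ∑ x ∈ φ.roots.toFinset.filter (fun x => 0 < x), φ.rootMultiplicity x
      ≤ ∑ x ∈ φ.roots.toFinset.filter (fun x => 0 < x), 1 := Finset.sum_le_sum hmult
    _ = (φ.roots.toFinset.filter (fun x => 0 < x)).card := by simp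
    _ ≤ 1 := hcard

/-! ### 3. The four-nomial lemma -/

/-- **Four-nomial lemma.**  For `A, B, C, D ≥ 0` with `B·C ≤ A·D` and exponents `p`, `q`, `0 < g`, the fewnomial
`A X^p − B X^{p+g} + C X^{p+q} − D X^{p+q+g} = X^p [(A − B X^g) + X^q (C − D X^g)]` has at most ONE positive root,
multiplicities included: it is positive while `D X^g < C` (there `B X^g ≤ BC/D ≤ A`) and strictly decreasing once
`D X^g ≥ C` (Euler's operator `x φ′ = −gB x^g + qC x^q − (q+g)D x^{q+g} < 0` there). [folklore] -/
theorem fourNomial_countP_posRoots_le_one (A B Cc D : ℝ) (hA : 0 ≤ A) (hB : 0 ≤ B) (hC : 0 ≤ Cc) (hD : 0 ≤ D)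
    (hlev : B * Cc ≤ A * D) (p g q : ℕ) (hg : 0 < g) :
    (C A * X ^ p - C B * X ^ (p + g) + C Cc * X ^ (p + q) - C D * X ^ (p + q + g)).roots.countP
      (fun x => 0 < x) ≤ 1 := by
  -- pull out `X^p`
  have hfac : C A * X ^ p - C B * X ^ (p + g) + C Cc * X ^ (p + q) - C D * X ^ (p + q + g)
      = X ^ p * (C A * X ^ 0 + C (-B) * X ^ g + C Cc * X ^ q + C (-D) * X ^ (q + g)) := by
    simp only [map_neg, pow_add, pow_zero]
    ring
  rw [hfac, Census.countP_posRoots_X_pow_mul]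
  set φ : ℝ[X] := C A * X ^ 0 + C (-B) * X ^ g + C Cc * X ^ q + C (-D) * X ^ (q + g) with hφ
  have heval : ∀ x : ℝ, φ.eval x = A - B * x ^ g + x ^ q * (Cc - D * x ^ g) := by
    intro x
    simp only [hφ, eval_add, eval_mul, eval_C, eval_pow, eval_X, pow_add]
    ring
  rcases hD.eq_or_lt with hD0 | hDpos
  · -- `D = 0`: then `B = 0` or `C = 0`
    have hBC : B * Cc = 0 := le_antisymm (by rw [← hD0, mul_zero] at hlev; exact hlev) (mul_nonneg hB hC)
    rcases mul_eq_zero.mp hBC with hB0 | hC0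
    · -- all coefficients `≥ 0`: no positive root
      have hnn : ∀ n, 0 ≤ φ.coeff n := by
        intro n
        simp only [hφ, ← hD0, hB0, neg_zero, map_zero, zero_mul, add_zero, coeff_add, coeff_C_mul,
          coeff_X_pow]
        split_ifs <;> nlinarith
      have hV := Literature.Algebra.Polynomial.Descartes.signVariations_eq_zero_of_coeff_nonneg hnn
      have := φ.roots_countP_pos_le_signVariations
      omega
    · -- `φ = A − B X^g`
      rcases hB.eq_or_lt with hB0 | hBpos
      · have hnn : ∀ n, 0 ≤ φ.coeff n := by
          intro n
          simp only [hφ, ← hD0, ← hB0, hC0, neg_zero, map_zero, zero_mul, add_zero, coeff_C_mul,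
            coeff_X_pow]
          split_ifs <;> nlinarith
        have hV := Literature.Algebra.Polynomial.Descartes.signVariations_eq_zero_of_coeff_nonneg hnn
        have := φ.roots_countP_pos_le_signVariations
        omega
      · refine countP_posRoots_le_one_of_pos_of_deriv_neg φ 0 (fun x hx hx0 => absurd hx0 (not_lt.mpr hx.le))
          fun x _ hx => ?_
        have h1 : (X * derivative φ).eval x < 0 := by
          rw [hφ, eval_X_mul_derivative_fourNomial, ← hD0, hC0]
          simp only [Nat.cast_zero, zero_mul, neg_zero, mul_zero, add_zero, zero_add]
          have : 0 < (g : ℝ) * B * x ^ g := by positivity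
          linarith
        have h2 : (X * derivative φ).eval x = x * φ.derivative.eval x := by rw [eval_mul, eval_X]
        rw [h2] at h1
        rcases lt_or_ge (φ.derivative.eval x) 0 with h' | h'
        · exact h'
        · exact absurd h1 (not_lt.mpr (mul_nonneg hx.le h'))
  · -- `D > 0`: threshold `x₀` with `x₀ ^ g = C / D`
    set x₀ : ℝ := (Cc / D) ^ ((g : ℝ)⁻¹) with hx₀
    have hx₀nn : 0 ≤ x₀ := Real.rpow_nonneg (div_nonneg hC hDpos.le) _
    have hx₀g : x₀ ^ g = Cc / D := Real.rpow_inv_natCast_pow (div_nonneg hC hDpos.le) hg.ne'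
    refine countP_posRoots_le_one_of_pos_of_deriv_neg φ x₀ (fun x hx hxx₀ => ?_) (fun x hx₀x hx => ?_)
    · -- positivity below the threshold
      have hxg : x ^ g < Cc / D := by
        rw [← hx₀g]; exact pow_lt_pow_left₀ hxx₀ hx.le hg.ne'
      have h1 : D * x ^ g < Cc := by rwa [lt_div_iff₀ hDpos, mul_comm] at hxg
      have h2 : B * x ^ g ≤ A := by
        have : B * x ^ g * D ≤ B * Cc := by nlinarith [pow_nonneg hx.le g]
        nlinarith
      rw [heval]
      have : 0 < x ^ q * (Cc - D * x ^ g) := mul_pos (pow_pos hx q) (by linarith)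
      linarith
    · -- strict decrease beyond the threshold, via Euler's operator
      have hxg : Cc / D ≤ x ^ g := by
        rw [← hx₀g]; exact pow_le_pow_left₀ hx₀nn hx₀x g
      have h1 : Cc ≤ D * x ^ g := by rwa [div_le_iff₀ hDpos, mul_comm] at hxg
      have hE : (X * derivative φ).eval x < 0 := by
        rw [hφ, eval_X_mul_derivative_fourNomial]
        simp only [Nat.cast_zero, zero_mul, Nat.cast_add]
        have hxq : 0 < x ^ q := pow_pos hx q
        have hxgp : 0 < x ^ g := pow_pos hx g
        have key : (q : ℝ) * Cc * x ^ q - ((q : ℝ) + g) * D * x ^ (q + g) < 0 := by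
          rw [pow_add]
          have hq0 : (0 : ℝ) ≤ q := Nat.cast_nonneg q
          have hg0 : (0 : ℝ) < g := by exact_mod_cast hg
          nlinarith [mul_nonneg hq0 (mul_nonneg hxq.le (sub_nonneg.mpr h1)),
            mul_pos (mul_pos hg0 hDpos) (mul_pos hxq hxgp)]
        nlinarith [mul_nonneg (mul_nonneg (Nat.cast_nonneg g) hB) hxgp.le]
      have h2 : (X * derivative φ).eval x = x * φ.derivative.eval x := by rw [eval_mul, eval_X]
      rw [h2] at hE
      rcases lt_or_ge (φ.derivative.eval x) 0 with h' | h'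
      · exact h'
      · exact absurd hE (not_lt.mpr (mul_nonneg hx.le h'))

/-! ### 4. Mixed discriminants of `2 × 2` letters and the lever -/

/-- Non-negativity of the mixed discriminant `x₁y₃ + x₃y₁ − 2x₂y₂` of two PSD real symmetric `2 × 2` matrices given by
their entries `(x₁₁, x₁₂, x₂₂) = (x₁, x₂, x₃)` (the tree's `Pivot.TwoDescartes.mixedDisc_nonneg`, reordered). [folklore] -/
theorem mix_nonneg' (x₁ x₂ x₃ y₁ y₂ y₃ : ℝ) (hx₁ : 0 ≤ x₁) (hx₃ : 0 ≤ x₃) (hx : x₂ * x₂ ≤ x₁ * x₃)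
    (hy₁ : 0 ≤ y₁) (hy₃ : 0 ≤ y₃) (hy : y₂ * y₂ ≤ y₁ * y₃) : 0 ≤ x₁ * y₃ + x₃ * y₁ - 2 * (x₂ * y₂) := by
  have h := Pivot.TwoDescartes.mixedDisc_nonneg x₁ x₂ x₃ y₁ y₂ y₃ hx₁ hx₃ hy₁ hy₃ hx hy
  linarith [mul_comm x₃ y₁]

/-- **The lever** (seat val-sym-mdr-p1 g4, paper; kernel here).  For a real symmetric `2 × 2` matrix `A = (a₁,a₂,a₃)`
(ANY signature) and PSD real symmetric `B`, `Q` (entries `(x₁₁, x₁₂, x₂₂)` with `x₁₁, x₂₂ ≥ 0`, `x₁₂² ≤ x₁₁ x₂₂`):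
`det(A) · mix(B,Q) ≤ mix(A,B) · mix(A,Q)` with `mix(X,Y) = x₁₁y₂₂ + x₂₂y₁₁ − 2x₁₂y₁₂`.  PROOF:
`mix(A,B)·mix(A,Q) − det(A)·mix(B,Q) = tr(adj(A)·B·adj(A)·Q)`, a pairing of the PSD matrices `M = adj(A) B adj(A)`
and `Q`, hence `≥ 0` (tree `Pivot.TwoDescartes.mixedDisc_nonneg` applied to `M` and `adj Q`). [folklore] -/
theorem lever (a₁ a₂ a₃ b₁ b₂ b₃ q₁ q₂ q₃ : ℝ)
    (hb₁ : 0 ≤ b₁) (hb₃ : 0 ≤ b₃) (hb : b₂ * b₂ ≤ b₁ * b₃) (hq₁ : 0 ≤ q₁) (hq₃ : 0 ≤ q₃) (hq : q₂ * q₂ ≤ q₁ * q₃) :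
    (a₁ * a₃ - a₂ * a₂) * (b₁ * q₃ + b₃ * q₁ - 2 * (b₂ * q₂))
      ≤ (a₁ * b₃ + a₃ * b₁ - 2 * (a₂ * b₂)) * (a₁ * q₃ + a₃ * q₁ - 2 * (a₂ * q₂)) := by
  -- `M = adj(A) · B · adj(A)` with `adj(A) = [[a₃, −a₂], [−a₂, a₁]]`
  set m₁ : ℝ := a₃ * a₃ * b₁ - 2 * (a₂ * a₃) * b₂ + a₂ * a₂ * b₃ with hm₁
  set m₃ : ℝ := a₂ * a₂ * b₁ - 2 * (a₁ * a₂) * b₂ + a₁ * a₁ * b₃ with hm₃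
  set m₂ : ℝ := -(a₂ * a₃) * b₁ + (a₁ * a₃ + a₂ * a₂) * b₂ - a₁ * a₂ * b₃ with hm₂
  have hM₁ : 0 ≤ m₁ := by
    have := Pivot.TwoDescartes.mixedDisc_nonneg b₁ b₂ b₃ (a₂ * a₂) (a₂ * a₃) (a₃ * a₃) hb₁ hb₃
      (mul_self_nonneg _) (mul_self_nonneg _) hb (by nlinarith)
    rw [hm₁]; linarith
  have hM₃ : 0 ≤ m₃ := by
    have := Pivot.TwoDescartes.mixedDisc_nonneg b₁ b₂ b₃ (a₁ * a₁) (a₁ * a₂) (a₂ * a₂) hb₁ hb₃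
      (mul_self_nonneg _) (mul_self_nonneg _) hb (by nlinarith)
    rw [hm₃]; linarith
  have hdetM : m₁ * m₃ - m₂ * m₂ = (a₁ * a₃ - a₂ * a₂) ^ 2 * (b₁ * b₃ - b₂ * b₂) := by
    rw [hm₁, hm₂, hm₃]; ring
  have hM : m₂ * m₂ ≤ m₁ * m₃ := by nlinarith [sq_nonneg (a₁ * a₃ - a₂ * a₂)]
  -- `tr(M Q) = mixedDisc(M, adj Q) ≥ 0`
  have htr := Pivot.TwoDescartes.mixedDisc_nonneg m₁ m₂ m₃ q₃ (-q₂) q₁ hM₁ hM₃ hq₃ hq₁ hM (by linarith)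
  have hid : (a₁ * b₃ + a₃ * b₁ - 2 * (a₂ * b₂)) * (a₁ * q₃ + a₃ * q₁ - 2 * (a₂ * q₂))
        - (a₁ * a₃ - a₂ * a₂) * (b₁ * q₃ + b₃ * q₁ - 2 * (b₂ * q₂))
      = m₁ * q₁ + m₃ * q₃ - 2 * (m₂ * -q₂) := by
    rw [hm₁, hm₂, hm₃]; ring
  linarith

/-- **Strictness of the pairing.**  For a positive DEFINITE `B` (`b₁₂² < b₁₁b₂₂`, `b₁₁ ≥ 0`) and a positive semidefinite
`A` (`2 × 2`, real symmetric, by entries): `mix(B,A) ≤ 0 ⇒ A = 0` — `mix(B,A) = tr(adj(B)·A)` pairs a definite and a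
semidefinite matrix and vanishes only at `A = 0`. [folklore] -/
theorem eq_zero_of_mix_nonpos (b₁ b₂ b₃ a₁ a₂ a₃ : ℝ) (hb₁ : 0 ≤ b₁) (hb : b₂ * b₂ < b₁ * b₃)
    (ha₁ : 0 ≤ a₁) (ha₃ : 0 ≤ a₃) (ha : a₂ * a₂ ≤ a₁ * a₃) (hmix : b₁ * a₃ + b₃ * a₁ - 2 * (b₂ * a₂) ≤ 0) :
    a₁ = 0 ∧ a₂ = 0 ∧ a₃ = 0 := by
  have hb₁' : 0 < b₁ := by
    rcases hb₁.eq_or_lt with h | h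
    · rw [← h, zero_mul] at hb; nlinarith
    · exact h
  have hb₃' : 0 < b₃ := by nlinarith
  have h1 : b₁ * a₃ + b₃ * a₁ ≤ 2 * (b₂ * a₂) := by linarith
  have h2 : 0 ≤ b₁ * a₃ + b₃ * a₁ := by positivity
  have h3 : (b₁ * a₃ + b₃ * a₁) ^ 2 ≤ 4 * (b₂ * b₂) * (a₂ * a₂) := by nlinarith
  have h4 : 4 * (b₁ * b₃) * (a₁ * a₃) ≤ (b₁ * a₃ + b₃ * a₁) ^ 2 := by nlinarith [sq_nonneg (b₁ * a₃ - b₃ * a₁)]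
  have h5 : a₁ * a₃ = 0 := by
    by_contra hne
    have hpos : 0 < a₁ * a₃ := lt_of_le_of_ne (mul_nonneg ha₁ ha₃) (Ne.symm hne)
    nlinarith
  have h6 : a₂ = 0 := by nlinarith
  have h7 : b₁ * a₃ + b₃ * a₁ ≤ 0 := by rw [h6, mul_zero, mul_zero] at h1; exact h1
  refine ⟨by nlinarith, h6, by nlinarith⟩

/-! ### 5. The exponent-multiplier inequalities on the chamber `a < g < c < a + g` -/

/-- **Six-twist multiplier inequality** on the chamber `0 < a < g < c < a + g`:
`8(g−a)(2a+c)(c−g)(a+g−c)(a+g+c)² ≤ (2g+a+c)(2a+g)(2a+g+c)(2a+2c+g)(g+c)(c−a)` — by `(c−g)(a+g−c) ≤ a²/4` and the five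
monotone factor bounds `2a² ≤ (2a+g)(g+c)`, `g−a ≤ c−a`, `2a+c ≤ 2a+g+c`, `a+g+c ≤ 2a+2c+g`, `a+g+c ≤ 2g+a+c` (the true
minimum of the ratio over the chamber is ≈ 33). [folklore] -/
theorem multiplier_ineq_six (a g c : ℝ) (ha : 0 < a) (hag : a < g) (hgc : g < c) (hcag : c < a + g) :
    8 * (g - a) * (2 * a + c) * (c - g) * (a + g - c) * (a + g + c) ^ 2
      ≤ (2 * g + a + c) * (2 * a + g) * (2 * a + g + c) * (2 * a + 2 * c + g) * (g + c) * (c - a) := by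
  have h0 : 0 ≤ g - a := by linarith
  have h0' : 0 ≤ c - a := by linarith
  have h1 : 4 * ((c - g) * (a + g - c)) ≤ a ^ 2 := by nlinarith [sq_nonneg (c - g - (a + g - c))]
  have hP : 0 ≤ (g - a) * (2 * a + c) * (a + g + c) ^ 2 :=
    mul_nonneg (mul_nonneg h0 (by linarith)) (sq_nonneg _)
  have hA : 8 * (g - a) * (2 * a + c) * (c - g) * (a + g - c) * (a + g + c) ^ 2
      ≤ 2 * a ^ 2 * (g - a) * (2 * a + c) * ((a + g + c) * (a + g + c)) := by
    have := mul_le_mul_of_nonneg_right h1 hP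
    nlinarith
  have f1 : 2 * a ^ 2 ≤ (2 * a + g) * (g + c) := by nlinarith
  have n1 : 0 ≤ (2 * a + g) * (g + c) := mul_nonneg (by linarith) (by linarith)
  have n2 : 0 ≤ (2 * a + g) * (g + c) * (c - a) := mul_nonneg n1 h0'
  have n3 : 0 ≤ (2 * a + g) * (g + c) * (c - a) * (2 * a + g + c) := mul_nonneg n2 (by linarith)
  have n4 : 0 ≤ (a + g + c) * (a + g + c) := mul_nonneg (by linarith) (by linarith)
  have hB : 2 * a ^ 2 * (g - a) * (2 * a + c) * ((a + g + c) * (a + g + c))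
      ≤ ((2 * a + g) * (g + c)) * (c - a) * (2 * a + g + c) * ((2 * a + 2 * c + g) * (2 * g + a + c)) := by
    gcongr ?_ * ?_ * ?_ * (?_ * ?_)
    all_goals linarith
  calc _ ≤ _ := hA
    _ ≤ _ := hB
    _ = _ := by ring

end Summit.ValiantsHypothesis.ValiantsHypothesis.Theorems.LacunarySymmetroidMatrixDescartes.WLawTwoSix
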